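import Summits.Ventures.LatticeQCDFlow.Scaling.FlowLipschitzBudget

/-!
# LatticeQCDFlow / Scaling — the co-Lipschitz (heating) budget of an exact flow: Grönwall backwards in time

HONEST FRAMING: exact (Metropolis-corrected) sampling algorithms for lattice gauge theory; figures of merit are
autocorrelation/cost numbers at stated couplings and volumes; no continuum-physics claim.

Venture `LatticeQCDFlow` (cell pub-lqcd), topic `Scaling`, FANOUT row 30 (lean-1) — OUR WORK, the mirror of
`Scaling/FlowLipschitzBudget.lean`.  A flow map is invertible and its inverse is the flow of the time-reversed field, so
the SAME Lipschitz modulus `K` of the generating field bounds the CO-Lipschitz constant of `𝓕₁`: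

* `antilipschitzWith_flowMap_one` — Grönwall applied to the reversed flow lines `s ↦ Φ (1 - s) V` (which solve
  `Ẇ = -vf₀ Z (1 - s) W`): `dist V W ≤ e^K · dist (Φ 1 V) (Φ 1 W)`, i.e. `Φ 1` is `e^K`-co-Lipschitz
  (`AntilipschitzWith`);
* `flow_heating_budget` — with theory-2's constant-free HEATING window law (`SUN.calibratedHeatingWindow_zero`): if
  `Φ 1` transports `μ_{Λ,β₀}` onto a HOTTER law `μ_{Λ,β}` (`0 ≤ β ≤ β₀`) then for every configuration `U`,
  `(β₀ - β)·(S(U) - ⟨S⟩_{Λ,β}) ≤ (n² - 1)·#E·K`; `flow_heating_budget_su3`: `8·#E·K ≥ (β₀ - β)·(S(U) - ⟨S⟩_β)`.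

Together with `flow_lipschitz_budget`: an exact flow between `SU(n)` Wilson laws in EITHER direction pays, in the
Lipschitz modulus of its generating field integrated over unit flow time, at least the measured action deficit
`|β - β₀|·(S_max - ⟨S⟩_{hotter law})/((n² - 1)·#E)`.  Elementary given the tree; nothing is cited as a fact.
-/

noncomputable section

open scoped Matrix.Norms.Frobenius NNReal
open MeasureTheory Metric Set Filter Topology
open Literature.MathematicalPhysics.QuantumFieldTheory
open Literature.MathematicalPhysics.QuantumFieldTheory.Luscher2010
open Literature.MathematicalPhysics.QuantumLattice (fundamentalRep)

namespace Summit.Ventures.LatticeQCDFlow.Theory2.Lattice.SUN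

section Gronwall

variable {d L n : ℕ} [NeZero L]

/-- **Grönwall backwards: flow maps are co-Lipschitz.**  If the ambient field of the generator is `K`-Lipschitz on
the field manifold for `t ∈ (0, 1]`, then `dist V W ≤ e^K·dist (Φ 1 V) (Φ 1 W)`: `Φ 1` is `e^K`-co-Lipschitz.
[folklore] -/
theorem antilipschitzWith_flowMap_one {Z : Generator d L n}
    {Φ : ℝ → GaugeConfig d L (Matrix.specialUnitaryGroup (Fin n) ℂ) →
      GaugeConfig d L (Matrix.specialUnitaryGroup (Fin n) ℂ)}
    (hΦ : IsFlowMap Z Φ) {K : ℝ≥0}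
    (hK : ∀ t ∈ Ioc (0 : ℝ) 1, LipschitzOnWith K (FlowExistence.vf₀ Z t) (Set.range WilsonFlow.coeConfig)) :
    AntilipschitzWith (Real.toNNReal (Real.exp K)) (Φ 1) := by
  refine AntilipschitzWith.of_le_mul_dist fun V W => ?_
  -- reversed flow lines
  set f : ℝ → AmbConfig d L n := fun s => WilsonFlow.coeConfig (Φ (1 - s) V) with hf
  set g : ℝ → AmbConfig d L n := fun s => WilsonFlow.coeConfig (Φ (1 - s) W) with hg
  -- the reversed field
  set v : ℝ → AmbConfig d L n → AmbConfig d L n := fun s X => -FlowExistence.vf₀ Z (1 - s) X with hv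
  have hfd : ∀ s, HasDerivAt f (v s (f s)) s := by
    intro s
    have h1 : HasDerivAt (fun t => WilsonFlow.coeConfig (Φ t V)) (FlowExistence.vf₀ Z (1 - s)
        (WilsonFlow.coeConfig (Φ (1 - s) V))) (1 - s) := FlowExistence.hasDerivAt_of_isFlowLine (hΦ.2 V) (1 - s)
    have h2 : HasDerivAt (fun s : ℝ => 1 - s) (-1) s := by simpa using (hasDerivAt_id s).const_sub 1
    have h := h1.scomp s h2
    simp only [neg_one_smul] at h
    exact h
  have hgd : ∀ s, HasDerivAt g (v s (g s)) s := by
    intro s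
    have h1 : HasDerivAt (fun t => WilsonFlow.coeConfig (Φ t W)) (FlowExistence.vf₀ Z (1 - s)
        (WilsonFlow.coeConfig (Φ (1 - s) W))) (1 - s) := FlowExistence.hasDerivAt_of_isFlowLine (hΦ.2 W) (1 - s)
    have h2 : HasDerivAt (fun s : ℝ => 1 - s) (-1) s := by simpa using (hasDerivAt_id s).const_sub 1
    have h := h1.scomp s h2
    simp only [neg_one_smul] at h
    exact h
  have hvK : ∀ s ∈ Ico (0 : ℝ) 1, LipschitzOnWith K (v s) (Set.range WilsonFlow.coeConfig) := by
    intro s hs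
    have h := (hK (1 - s) ⟨by linarith [hs.2], by linarith [hs.1]⟩).neg
    exact h
  have h := dist_le_of_trajectories_ODE_of_mem (v := v)
    (s := fun _ => Set.range WilsonFlow.coeConfig) (K := K) (f := f) (g := g) (a := 0) (b := 1)
    (δ := dist (f 0) (g 0)) hvK
    (fun t _ => (hfd t).continuousAt.continuousWithinAt) (fun t _ => (hfd t).hasDerivWithinAt)
    (fun t _ => ⟨Φ (1 - t) V, rfl⟩)
    (fun t _ => (hgd t).continuousAt.continuousWithinAt) (fun t _ => (hgd t).hasDerivWithinAt)
    (fun t _ => ⟨Φ (1 - t) W, rfl⟩) le_rfl 1 (right_mem_Icc.2 zero_le_one)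
  rw [hf, hg] at h
  simp only [dist_coeConfig, sub_self, hΦ.1, sub_zero, mul_one] at h
  rw [Real.coe_toNNReal _ (Real.exp_pos _).le, mul_comm]
  exact h

end Gronwall

section Budget

variable {L : ℕ} [NeZero L]

/-- **The co-Lipschitz (heating) budget of an exact flow** (OURS; `SU(n)`, `n ≥ 1`): if a flow map `Φ` of a
generator whose ambient field is `K`-Lipschitz on the field manifold for `t ∈ (0, 1]` transports `μ_{Λ,β₀}` onto the
HOTTER `μ_{Λ,β}` (`0 ≤ β ≤ β₀`), then for every configuration `U`, `(β₀ - β)·(S(U) - ⟨S⟩_{Λ,β}) ≤ #E·((n² - 1)·K)`.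
[folklore] -/
theorem flow_heating_budget (d n : ℕ) (hn : 1 ≤ n) {Z : Generator d L n}
    {Φ : ℝ → GaugeConfig d L (Matrix.specialUnitaryGroup (Fin n) ℂ) →
      GaugeConfig d L (Matrix.specialUnitaryGroup (Fin n) ℂ)}
    (hΦ : IsFlowMap Z Φ) {K : ℝ≥0}
    (hK : ∀ t ∈ Ioc (0 : ℝ) 1, LipschitzOnWith K (FlowExistence.vf₀ Z t) (Set.range WilsonFlow.coeConfig))
    {β β₀ : ℝ} (hβ : 0 ≤ β) (hββ₀ : β ≤ β₀)
    (hmap : (wilsonMeasure (d := d) (L := L) (fundamentalRep (Fin n)) β₀).map (Φ 1) =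
      wilsonMeasure (d := d) (L := L) (fundamentalRep (Fin n)) β)
    (U : GaugeConfig d L (Matrix.specialUnitaryGroup (Fin n) ℂ)) :
    (β₀ - β) * (wilsonAction (fundamentalRep (Fin n)) U -
        wilsonExpectation (d := d) (L := L) (fundamentalRep (Fin n)) β
          (wilsonAction (d := d) (L := L) (fundamentalRep (Fin n)))) ≤
      Fintype.card (Edge d L) * (((n * n - 1 : ℕ) : ℝ) * K) := by
  have hW := calibratedHeatingWindow_zero d n hn
  have hpos : 0 < ((Real.toNNReal (Real.exp K) : ℝ≥0) : ℝ) := by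
    rw [Real.coe_toNNReal _ (Real.exp_pos _).le]; exact Real.exp_pos _
  have h := hW L β β₀ hβ hββ₀ (Φ 1) (Real.toNNReal (Real.exp K)) hpos (antilipschitzWith_flowMap_one hΦ hK)
    hmap U
  rw [Real.coe_toNNReal _ (Real.exp_pos _).le, Real.log_exp, zero_add] at h
  exact h

/-- **`SU(3)` reading**: `8·#E·K ≥ (β₀ - β)·(S(U) - ⟨S⟩_{Λ,β})` for every exact HEATING flow of `SU(3)` Wilson laws
whose generating field is `K`-Lipschitz on the field manifold (every `d`; `d = 4`: `#E = 4L⁴`). [folklore] -/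
theorem flow_heating_budget_su3 (d : ℕ) {Z : Generator d L 3}
    {Φ : ℝ → GaugeConfig d L (Matrix.specialUnitaryGroup (Fin 3) ℂ) →
      GaugeConfig d L (Matrix.specialUnitaryGroup (Fin 3) ℂ)}
    (hΦ : IsFlowMap Z Φ) {K : ℝ≥0}
    (hK : ∀ t ∈ Ioc (0 : ℝ) 1, LipschitzOnWith K (FlowExistence.vf₀ Z t) (Set.range WilsonFlow.coeConfig))
    {β β₀ : ℝ} (hβ : 0 ≤ β) (hββ₀ : β ≤ β₀)
    (hmap : (wilsonMeasure (d := d) (L := L) (fundamentalRep (Fin 3)) β₀).map (Φ 1) =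
      wilsonMeasure (d := d) (L := L) (fundamentalRep (Fin 3)) β)
    (U : GaugeConfig d L (Matrix.specialUnitaryGroup (Fin 3) ℂ)) :
    (β₀ - β) * (wilsonAction (fundamentalRep (Fin 3)) U -
        wilsonExpectation (d := d) (L := L) (fundamentalRep (Fin 3)) β
          (wilsonAction (d := d) (L := L) (fundamentalRep (Fin 3)))) ≤
      Fintype.card (Edge d L) * (8 * K) := by
  have h := flow_heating_budget d 3 (by norm_num) hΦ hK hβ hββ₀ hmap U
  have h8 : ((3 * 3 - 1 : ℕ) : ℝ) = 8 := by norm_num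
  rw [h8] at h
  exact h

end Budget

end Summit.Ventures.LatticeQCDFlow.Theory2.Lattice.SUN

end
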